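/-
Copyright (c) 2026 the pub-hodgecm-mathlib formalisation cell (harness21).  Prover seat hodgecm-mathlib-F0P3-p01 (g30), «(D-RAM) FOUR-FRAME» road of crux H413, line LH4, unit U3 §K-R
(dealer LH4-plan (g10) WORD #50 deal «K-SGN-R RE-LINE PREP (KSS)», HOME-first, count-neutral): the SIGN twin of ★ p855529 — the re-cut κ-SIGN law at a datum from (NI2) (★ p855402) and the
EIGHTFOLD SIGNED κ-MODEL SUM (KSS), over LH4-p09 (g2)'s ★ p855505 sign-class bridge.  No U3 edition rides on this file until TW4's sign rows are re-fit «=» (T18-22 (2)) and the LEAD rules.  2026-09-03∕04.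
-/
import Summits.HodgeConjecture.HodgeConjecture.Theorems.F0P3cDyRamKappaAbsLawOfKappaModelSum   -- ★ p855529 (this seat): `chiSum_eq_unitSign_mul_chiSum`; brings ★ p855505 (LH4-p09) `two_mul_sum_kappaChar_mul_fixedVertexCount_eq_sum_signClasses`, ★ №1-R `KappaSignLawAtS∕AtR`, `shiftR`, ★ №1 `dyadicFence_of`, ★ p855402 `normIndexTwo`, ★ p855115 `normSign_eq_one_or`
import HarnessLib

/-!
# F0 · P3c · line LH4 «(D-RAM) FOUR-FRAME» — unit U3 §K-R: THE κ-SIGN LAW AT A DATUM FROM (NI2) + THE EIGHTFOLD SIGNED κ-MODEL SUM (KSS) — the payer-side plumbing of a future re-line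
# «K-SGN-R := NI2 ⊕ KSS» (Rogawski 1990 §3.6, §4.9 Prop. 4.9.1 (a); Langlands–Shelstad 1987 §1.3)

Cell `pub/hodgecm-mathlib`, crux H413 = `stmt-HodgeConjecture-24833` (helper lane `--supports stmt-HodgeConjecture-24833 --as helper`), route HCCMUnconditional; THEOREMS ONLY
(no definition, no instance, no notation, no named fact, no `sorry`, no `set_option` beyond `autoImplicit false`; default heartbeats).

WHAT IS PROVED — the sign-exact twin of ★ p855529 `kappaAmplitudeLawAtS_of_normIndexTwo_of_kappaModelSum8`.  For any schedule `shift`, threshold `N₀`, type shift `τ` and datum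
`(K, σ, ϖ, d, t)`: if (NI2) some `σ`-fixed unit `c` satisfies the index-two dichotomy and (KSS) for every such `c`, every anti-fixed `δ ≠ 0`, every `a, b` with `aσa = bσb = 1`,
`v(a − 1), v(b − 1) < v 2`, every element datum `(a², b²; n₁, n₂, n₃)` at `N₀ d`, `T = diag(a², b², 1)`, every `k` with `2k + d = Σn + 2`, every `i` and parity datum `2B = n_i − d + 2 − 2·shift d t`:
  `Σ_{s : Fin 3 → Bool} χ⁰_i(s)·C₀(s) = 2·w_i·S_i·ampl q k B`  and  `Σ_s χ⁰_i(s)·C₂(s) = 2·w_i·S_i·ampl q k (B + τ d)`  (over `ℚ`),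
with `C_t(s) = #{M : M a type-t vertex lattice of (K³, diag(d_s)), T·M = M}` (`d_s j = c` if `s j` else `1`), the w-FREE characters `χ⁰_0 = sgn(s 1)sgn(s 2)`, `χ⁰_1 = sgn(s 0)sgn(s 2)`,
`χ⁰_2 = sgn(s 0)sgn(s 1)` (the SAME left side as the registered (KMS) `U3_Laws.stub_U3_kappaModelSum`), the closed sign `w_i = (w, w, 1)_i`, `w = normSign σ (−1)`, and the law's own sign
`S_i = baseSign σ i · normSign σ (fPartProd δ (a, b, 1) i)` — THEN `KappaSignLawAtS shift N₀ τ σ ϖ d t` (★ №1-R §S verbatim, sign-exact): `kappaSignLawAtS_of_normIndexTwo_of_kappaSignModelSum8`.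
At `(shiftR, depthOfRecord, tauOfRecord)` with (NI2) DISCHARGED by ★ `normIndexTwo`:  **`dyadicFence_kappaSignLawAtR_of_kappaSignModelSum8 (σ ϖ d t) (hKSS) : DyadicFence (KappaSignLawAtR
depthOfRecord tauOfRecord σ ϖ d t)`** — the conclusion of `U3_Laws.stub_U3_kappaSignLawR` at the datum from ONE frame-free binder (KSS).  Nothing is claimed about (KSS): it is a BINDER.

THE MATHEMATICS.  ★ p855505: `2·X = Σ_s χ_i(s)·C_t(s)` for `X = Σ_b κ_i(b)·n_t(Γ_b)`; ★ p855529 §1: `Σ_s χ_i(s)·C_t(s) = w_i·Y`, `Y = Σ_s χ⁰_i(s)·C_t(s)`; (KSS): `Y = 2·w_i·S_i·A`; and `w_i² = 1`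
(★ `normSign_eq_one_or`) — so `2X = w_i·Y = 2·w_i²·S_i·A = 2·S_i·A`, i.e. `X = S_i·A`, the K-SGN clause (§1 `eq_of_two_mul_eq_of_eq_two_mul`, pure `ℚ`-algebra).  `T = diag(a², b², 1) ∈ GL₃`
since `a, b ≠ 0` (`aσa = 1`), as in ★ p855240 ∕ p855529.

EVIDENCE HONESTY (dealer WORD #50).  (KSS) is the ALGEBRAIC TRANSPORT of the registered K-SGN-R (equivalent to it under (NI2) + ★ p855505, factor `2·w_i`); it is NOT separately checked by the
(S-fin) engine `finite_engine2.py` (per-class UNSIGNED counts); its evidence is exactly K-SGN's frame-currency census (square-sign rows of record; at `d < t` the TW4 kit job `j348006` is the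
standing falsifier, T18-22 (2) un-gate pending).  A census law in model currency — a PROVER TARGET, never a literature fact.

* §1 `eq_of_two_mul_eq_of_eq_two_mul` (the `ℚ`-algebra), `two_mul_kappaSum_eq_unitSign_mul_chiSum` (`2·X = w_i·Y` over `ℚ`).
* §2 **`kappaSignLawAtS_of_normIndexTwo_of_kappaSignModelSum8`**, `dyadicFence_kappaSignLawAtS_of_normIndexTwo_of_kappaSignModelSum8`, **`dyadicFence_kappaSignLawAtR_of_kappaSignModelSum8`**.

HONEST LABEL: HC_CM is proved only modulo the 7 printed citations (2 remaining named inputs: hLiu418 = stmt-HodgeConjecture-24832, h413 = stmt-HodgeConjecture-24833) until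
rung 0 closes; count-neutral (`--supports`); the verdict of record for (D-RAM) stays PRINT [LanglandsShelstad1989 Thm. p. 484 ∕ Rogawski1990 Prop. 4.9.1 (a)].

## References
* [Rogawski1990] J. D. Rogawski, *Automorphic Representations of Unitary Groups in Three Variables*, Ann. of Math. Stud. 123 (1990), §3.6 pp. 28–29, §4.9 Prop. 4.9.1 (a) p. 55, §12.2.
* [LanglandsShelstad1987] R. P. Langlands, D. Shelstad, *On the definition of transfer factors*, Math. Ann. 278 (1987), §1.3 (the κ-signs of the classes in a stable class).
* [Jacobowitz1962] R. Jacobowitz, *Hermitian forms over local fields*, Amer. J. Math. 84 (1962), §4.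
-/

set_option autoImplicit false

noncomputable section

namespace Summit.HodgeConjecture.HodgeConjecture.Cruxes.H413.F0P3cDyRamKappaSignLawOfKappaModelSum

open Matrix
open Literature.NumberTheory.Automorphic Literature.NumberTheory.Automorphic.HermitianLattice Literature.NumberTheory.Automorphic.UnitaryGroup
open Literature.NumberTheory.Automorphic.UnitaryLatticeTree Literature.NumberTheory.Automorphic.UnitaryThreeFourFrame
open Summit.HodgeConjecture.HodgeConjecture.Cruxes.H413.F0P3cDyRamStableSumSignClasses
open Summit.HodgeConjecture.HodgeConjecture.Cruxes.H413.F0P3cDyRamKappaSumSignClasses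
open Summit.HodgeConjecture.HodgeConjecture.Cruxes.H413.F0P3cDyRamKappaAbsLawOfKappaModelSum
open Summit.HodgeConjecture.HodgeConjecture.Cruxes.H413.F0P3cDyRamFourFrameLawDefs
open Summit.HodgeConjecture.HodgeConjecture.Cruxes.H413.F0P3cDyRamFourFrameLawDefsR
open Summit.HodgeConjecture.HodgeConjecture.Cruxes.H413.F0P3cDyRamNormIndexTwo
open scoped Valued WithZero Matrix MatrixGroups

/-! ## §1 The sign algebra: `2X = w·Y`, `Y = 2·w·S·A`, `w² = 1 ⇒ X = S·A` -/

/-- Pure `ℚ`-algebra: `2X = wY`, `Y = 2wSA`, `w = ±1 ⇒ X = SA`. [cite: LanglandsShelstad1987, §1.3] -/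
theorem eq_of_two_mul_eq_of_eq_two_mul {X Y w S A : ℚ} (hw : w = 1 ∨ w = -1) (h2 : 2 * X = w * Y) (hY : Y = 2 * w * S * A) : X = S * A := by
  have hww : w * w = 1 := by rcases hw with rfl | rfl <;> norm_num
  have h : 2 * X = 2 * (w * w) * S * A := by rw [h2, hY]; ring
  rw [hww] at h
  linarith

section Sign

variable {K : Type} [Field K] [Valued K ℤᵐ⁰] {σ : K →+* K} {ϖ : K}

/-- **`2·Σ_b κ_i(b)·n_t(Γ_b) = w_i · Σ_s χ⁰_i(s)·C_t(s)` over `ℚ`** (`w_i = (w, w, 1)_i`, `w = normSign σ (−1)`): ★ p855505's bridge with the global sign pulled out of the characters (★ p855529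
`chiSum_eq_unitSign_mul_chiSum`), cast to `ℚ`. [cite: Rogawski1990, §3.6 pp. 28–29; §4.9 Prop. 4.9.1 (a) p. 55] [cite: LanglandsShelstad1987, §1.3] -/
theorem two_mul_kappaSum_eq_unitSign_mul_chiSum (hσ : ∀ x, σ (σ x) = x) (hvσ : ∀ a, Valued.v (σ a) = Valued.v a)
    (hϖ : Valued.v ϖ = WithZero.exp (-1 : ℤ)) (heven : ∀ x : K, σ x = x → x ≠ 0 → ∃ n : ℤ, Valued.v x = WithZero.exp (2 * n))
    {c : K} (hσc : σ c = c) (hvc : Valued.v c = 1)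
    (hdich : ∀ x : K, σ x = x → x ≠ 0 → (∃ z : K, z * σ z = x) ∨ ∃ z : K, z * σ z = c * x)
    {f : Fin 4 → Fin 3 → (Fin 3 → K)} (hf : IsFourFrameFamily σ f) (α β : K)
    (T : GL (Fin 3) K) (hT : (T : Matrix (Fin 3) (Fin 3) K) = Matrix.diagonal ![α, β, 1])
    (Γ : Fin 4 → GL (Fin 3) K) (hΓ : ∀ b, (Γ b : Matrix (Fin 3) (Fin 3) K) = frameElt σ f b α β) (t : ℕ) (i : Fin 3) :
    (2 : ℚ) * ((∑ b : Fin 4, kappaChar i b * (fixedVertexCount σ ϖ t (Γ b) : ℤ) : ℤ) : ℚ) =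
      (((![normSign σ (-1 : K), normSign σ (-1 : K), 1] : Fin 3 → ℤ) i : ℤ) : ℚ) *
        ((∑ s : Fin 3 → Bool,
          (![(if s 1 then -1 else 1) * (if s 2 then -1 else 1),
             (if s 0 then -1 else 1) * (if s 2 then -1 else 1),
             (if s 0 then -1 else 1) * (if s 1 then -1 else 1)] : Fin 3 → ℤ) i *
            ({M : Submodule 𝒪[K] (Fin 3 → K) |
              IsVertexLattice σ ϖ (Matrix.diagonal fun j => if s j then c else (1 : K)) t M ∧ mapGL T M = M}.ncard : ℤ) : ℤ) : ℚ) := by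
  have hbridge := two_mul_sum_kappaChar_mul_fixedVertexCount_eq_sum_signClasses hσ hvσ hϖ heven hσc hvc hdich hf α β T hT Γ hΓ t i
  rw [chiSum_eq_unitSign_mul_chiSum] at hbridge
  exact_mod_cast hbridge

end Sign

/-! ## §2 The κ-sign law at a datum from (NI2) + (KSS); the record instance with (NI2) discharged by ★ `normIndexTwo` -/

section Reduction

variable {K : Type} [Field K] [Valued K ℤᵐ⁰] [CompleteSpace K] [Fintype 𝓀[K]]

/-- **THE κ-SIGN LAW AT A DATUM FROM (NI2) + THE EIGHTFOLD SIGNED κ-MODEL SUM (KSS)** (any schedule `shift`, threshold `N₀`, type shift `τ`): `KappaSignLawAtS shift N₀ τ σ ϖ d t` (★ №1-R §S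
verbatim, sign-exact) follows from a `σ`-fixed unit `c` with the index-two dichotomy (NI2) and (KSS): for every such `c`, anti-fixed `δ ≠ 0`, `a, b` with `aσa = bσb = 1`, `v(a−1), v(b−1) < v 2`,
element datum `(a², b²; n)` at `N₀ d`, `T = diag(a², b², 1)`, `2k + d = Σn + 2`, `i`, `2B = n_i − d + 2 − 2·shift d t`:
`Σ_s χ⁰_i(s)·C₀(s) = 2·w_i·S_i·ampl q k B ∧ Σ_s χ⁰_i(s)·C₂(s) = 2·w_i·S_i·ampl q k (B + τ d)` — by §1. [cite: Rogawski1990, §4.9 Prop. 4.9.1 (a) p. 55] [cite: LanglandsShelstad1987, §1.3] -/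
theorem kappaSignLawAtS_of_normIndexTwo_of_kappaSignModelSum8 (shift : ℕ → ℕ → ℤ) (N₀ : ℕ → ℕ) (τ : ℕ → ℤ) (σ : K →+* K) (ϖ : K) (d t : ℕ)
    (hNI : ∃ c : K, σ c = c ∧ Valued.v c = 1 ∧ ∀ x : K, σ x = x → x ≠ 0 → (∃ z : K, z * σ z = x) ∨ ∃ z : K, z * σ z = c * x)
    (hKSS : ∀ c : K, σ c = c → Valued.v c = 1 → (∀ x : K, σ x = x → x ≠ 0 → (∃ z : K, z * σ z = x) ∨ ∃ z : K, z * σ z = c * x) →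
      ∀ (δ : K), σ δ = -δ → δ ≠ 0 →
      ∀ (a b : K), a * σ a = 1 → b * σ b = 1 → Valued.v (a - 1) < Valued.v (2 : K) → Valued.v (b - 1) < Valued.v (2 : K) →
      ∀ (n₁ n₂ n₃ : ℕ), IsElementDatum σ ϖ (N₀ d) (a * a) (b * b) n₁ n₂ n₃ →
      ∀ (T : GL (Fin 3) K), (T : Matrix (Fin 3) (Fin 3) K) = Matrix.diagonal ![a * a, b * b, 1] →
      ∀ (k : ℕ), 2 * k + d = n₁ + n₂ + n₃ + 2 →
      ∀ (i : Fin 3) (B : ℤ), 2 * B = ((![n₁, n₂, n₃] : Fin 3 → ℕ) i : ℤ) - d + 2 - 2 * shift d t →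
        ((∑ s : Fin 3 → Bool,
            (![(if s 1 then -1 else 1) * (if s 2 then -1 else 1),
               (if s 0 then -1 else 1) * (if s 2 then -1 else 1),
               (if s 0 then -1 else 1) * (if s 1 then -1 else 1)] : Fin 3 → ℤ) i *
              ({M : Submodule 𝒪[K] (Fin 3 → K) |
                IsVertexLattice σ ϖ (Matrix.diagonal fun j => if s j then c else (1 : K)) 0 M ∧ mapGL T M = M}.ncard : ℤ) : ℤ) : ℚ) =
          2 * (((![normSign σ (-1 : K), normSign σ (-1 : K), 1] : Fin 3 → ℤ) i * (baseSign σ i * normSign σ (fPartProd δ ![a, b, 1] i)) : ℤ) : ℚ) *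
            ampl (Fintype.card 𝓀[K]) k B ∧
        ((∑ s : Fin 3 → Bool,
            (![(if s 1 then -1 else 1) * (if s 2 then -1 else 1),
               (if s 0 then -1 else 1) * (if s 2 then -1 else 1),
               (if s 0 then -1 else 1) * (if s 1 then -1 else 1)] : Fin 3 → ℤ) i *
              ({M : Submodule 𝒪[K] (Fin 3 → K) |
                IsVertexLattice σ ϖ (Matrix.diagonal fun j => if s j then c else (1 : K)) 2 M ∧ mapGL T M = M}.ncard : ℤ) : ℤ) : ℚ) =
          2 * (((![normSign σ (-1 : K), normSign σ (-1 : K), 1] : Fin 3 → ℤ) i * (baseSign σ i * normSign σ (fPartProd δ ![a, b, 1] i)) : ℤ) : ℚ) *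
            ampl (Fintype.card 𝓀[K]) k (B + τ d)) :
    KappaSignLawAtS shift N₀ τ σ ϖ d t := by
  intro hD f hf δ hσδ hδ0 a b ha hb ha1 hb1 n₁ n₂ n₃ hE Γ hΓ k hk i B hB
  obtain ⟨hσ, hvσ, hϖ, heven, -, -, -⟩ := hD
  obtain ⟨c, hσc, hvc, hdich⟩ := hNI
  -- `a, b` are units (`a·σa = 1`)
  have ha0 : a ≠ 0 := fun h => by rw [h, zero_mul] at ha; exact zero_ne_one ha
  have hb0 : b ≠ 0 := fun h => by rw [h, zero_mul] at hb; exact zero_ne_one hb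
  -- the diagonal literal `T = diag(a², b², 1)` as a `GL₃` element
  obtain ⟨α, hα⟩ : ∃ α : K, α = a * a := ⟨_, rfl⟩
  obtain ⟨β, hβ⟩ : ∃ β : K, β = b * b := ⟨_, rfl⟩
  have hα0 : α ≠ 0 := hα ▸ mul_ne_zero ha0 ha0
  have hβ0 : β ≠ 0 := hβ ▸ mul_ne_zero hb0 hb0
  let T : GL (Fin 3) K :=
    ⟨Matrix.diagonal ![α, β, 1], Matrix.diagonal ![α⁻¹, β⁻¹, 1],
      by rw [Matrix.diagonal_mul_diagonal, ← Matrix.diagonal_one]; congr 1; funext j; fin_cases j <;> simp [hα0, hβ0],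
      by rw [Matrix.diagonal_mul_diagonal, ← Matrix.diagonal_one]; congr 1; funext j; fin_cases j <;> simp [hα0, hβ0]⟩
  have hT : (T : Matrix (Fin 3) (Fin 3) K) = Matrix.diagonal ![a * a, b * b, 1] := by rw [← hα, ← hβ]
  obtain ⟨hK0, hK2⟩ := hKSS c hσc hvc hdich δ hσδ hδ0 a b ha hb ha1 hb1 n₁ n₂ n₃ hE T hT k hk i B hB
  have h0 := two_mul_kappaSum_eq_unitSign_mul_chiSum hσ hvσ hϖ heven hσc hvc hdich hf (a * a) (b * b) T hT Γ hΓ 0 i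
  have h2 := two_mul_kappaSum_eq_unitSign_mul_chiSum hσ hvσ hϖ heven hσc hvc hdich hf (a * a) (b * b) T hT Γ hΓ 2 i
  -- `w_i = ±1`
  have hw : (((![normSign σ (-1 : K), normSign σ (-1 : K), 1] : Fin 3 → ℤ) i : ℤ) : ℚ) = 1 ∨
      (((![normSign σ (-1 : K), normSign σ (-1 : K), 1] : Fin 3 → ℤ) i : ℤ) : ℚ) = -1 := by
    rcases normSign_eq_one_or σ (-1 : K) with h | h <;> rw [h] <;> fin_cases i <;> simp
  constructor
  · refine eq_of_two_mul_eq_of_eq_two_mul hw h0 ?_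
    rw [hK0]; push_cast; ring
  · refine eq_of_two_mul_eq_of_eq_two_mul hw h2 ?_
    rw [hK2]; push_cast; ring

/-- **THE FENCED FORM**: `DyadicFence (KappaSignLawAtS shift N₀ τ σ ϖ d t)` from (NI2) + (KSS) (★ №1 `dyadicFence_of`). [cite: Rogawski1990, §4.9 Prop. 4.9.1 (a) p. 55] -/
theorem dyadicFence_kappaSignLawAtS_of_normIndexTwo_of_kappaSignModelSum8 (shift : ℕ → ℕ → ℤ) (N₀ : ℕ → ℕ) (τ : ℕ → ℤ) (σ : K →+* K) (ϖ : K) (d t : ℕ)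
    (hNI : ∃ c : K, σ c = c ∧ Valued.v c = 1 ∧ ∀ x : K, σ x = x → x ≠ 0 → (∃ z : K, z * σ z = x) ∨ ∃ z : K, z * σ z = c * x)
    (hKSS : ∀ c : K, σ c = c → Valued.v c = 1 → (∀ x : K, σ x = x → x ≠ 0 → (∃ z : K, z * σ z = x) ∨ ∃ z : K, z * σ z = c * x) →
      ∀ (δ : K), σ δ = -δ → δ ≠ 0 →
      ∀ (a b : K), a * σ a = 1 → b * σ b = 1 → Valued.v (a - 1) < Valued.v (2 : K) → Valued.v (b - 1) < Valued.v (2 : K) →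
      ∀ (n₁ n₂ n₃ : ℕ), IsElementDatum σ ϖ (N₀ d) (a * a) (b * b) n₁ n₂ n₃ →
      ∀ (T : GL (Fin 3) K), (T : Matrix (Fin 3) (Fin 3) K) = Matrix.diagonal ![a * a, b * b, 1] →
      ∀ (k : ℕ), 2 * k + d = n₁ + n₂ + n₃ + 2 →
      ∀ (i : Fin 3) (B : ℤ), 2 * B = ((![n₁, n₂, n₃] : Fin 3 → ℕ) i : ℤ) - d + 2 - 2 * shift d t →
        ((∑ s : Fin 3 → Bool,
            (![(if s 1 then -1 else 1) * (if s 2 then -1 else 1),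
               (if s 0 then -1 else 1) * (if s 2 then -1 else 1),
               (if s 0 then -1 else 1) * (if s 1 then -1 else 1)] : Fin 3 → ℤ) i *
              ({M : Submodule 𝒪[K] (Fin 3 → K) |
                IsVertexLattice σ ϖ (Matrix.diagonal fun j => if s j then c else (1 : K)) 0 M ∧ mapGL T M = M}.ncard : ℤ) : ℤ) : ℚ) =
          2 * (((![normSign σ (-1 : K), normSign σ (-1 : K), 1] : Fin 3 → ℤ) i * (baseSign σ i * normSign σ (fPartProd δ ![a, b, 1] i)) : ℤ) : ℚ) *
            ampl (Fintype.card 𝓀[K]) k B ∧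
        ((∑ s : Fin 3 → Bool,
            (![(if s 1 then -1 else 1) * (if s 2 then -1 else 1),
               (if s 0 then -1 else 1) * (if s 2 then -1 else 1),
               (if s 0 then -1 else 1) * (if s 1 then -1 else 1)] : Fin 3 → ℤ) i *
              ({M : Submodule 𝒪[K] (Fin 3 → K) |
                IsVertexLattice σ ϖ (Matrix.diagonal fun j => if s j then c else (1 : K)) 2 M ∧ mapGL T M = M}.ncard : ℤ) : ℤ) : ℚ) =
          2 * (((![normSign σ (-1 : K), normSign σ (-1 : K), 1] : Fin 3 → ℤ) i * (baseSign σ i * normSign σ (fPartProd δ ![a, b, 1] i)) : ℤ) : ℚ) *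
            ampl (Fintype.card 𝓀[K]) k (B + τ d)) :
    DyadicFence (K := K) (KappaSignLawAtS shift N₀ τ σ ϖ d t) :=
  dyadicFence_of (kappaSignLawAtS_of_normIndexTwo_of_kappaSignModelSum8 shift N₀ τ σ ϖ d t hNI hKSS)

/-- **THE RECORD INSTANCE WITH (NI2) DISCHARGED — the conclusion of `U3_Laws.stub_U3_kappaSignLawR` at the datum from the eightfold (KSS) alone**: at `(shiftR, depthOfRecord, tauOfRecord)`,
(KSS) implies `DyadicFence (KappaSignLawAtR depthOfRecord tauOfRecord σ ϖ d t)`; (NI2) is ★ `normIndexTwo`.  The assembly a later U3 edition could write for a FENCED + DATUM-GUARDED stub: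
`stub_U3_kappaSignLawR := fun σ ϖ d t h2 hD => dyadicFence_kappaSignLawAtR_of_kappaSignModelSum8 σ ϖ d t (stub_U3_kappaSignModelSum σ ϖ d t h2 hD) h2 hD` — NOT before TW4's sign rows are re-fit «=»
(T18-22 (2)) and the LEAD rules. [cite: Rogawski1990, §4.9 Prop. 4.9.1 (a) p. 55] [cite: LanglandsShelstad1987, §1.3] -/
theorem dyadicFence_kappaSignLawAtR_of_kappaSignModelSum8 (σ : K →+* K) (ϖ : K) (d t : ℕ)
    (hKSS : ∀ c : K, σ c = c → Valued.v c = 1 → (∀ x : K, σ x = x → x ≠ 0 → (∃ z : K, z * σ z = x) ∨ ∃ z : K, z * σ z = c * x) →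
      ∀ (δ : K), σ δ = -δ → δ ≠ 0 →
      ∀ (a b : K), a * σ a = 1 → b * σ b = 1 → Valued.v (a - 1) < Valued.v (2 : K) → Valued.v (b - 1) < Valued.v (2 : K) →
      ∀ (n₁ n₂ n₃ : ℕ), IsElementDatum σ ϖ (depthOfRecord d) (a * a) (b * b) n₁ n₂ n₃ →
      ∀ (T : GL (Fin 3) K), (T : Matrix (Fin 3) (Fin 3) K) = Matrix.diagonal ![a * a, b * b, 1] →
      ∀ (k : ℕ), 2 * k + d = n₁ + n₂ + n₃ + 2 →
      ∀ (i : Fin 3) (B : ℤ), 2 * B = ((![n₁, n₂, n₃] : Fin 3 → ℕ) i : ℤ) - d + 2 - 2 * shiftR d t →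
        ((∑ s : Fin 3 → Bool,
            (![(if s 1 then -1 else 1) * (if s 2 then -1 else 1),
               (if s 0 then -1 else 1) * (if s 2 then -1 else 1),
               (if s 0 then -1 else 1) * (if s 1 then -1 else 1)] : Fin 3 → ℤ) i *
              ({M : Submodule 𝒪[K] (Fin 3 → K) |
                IsVertexLattice σ ϖ (Matrix.diagonal fun j => if s j then c else (1 : K)) 0 M ∧ mapGL T M = M}.ncard : ℤ) : ℤ) : ℚ) =
          2 * (((![normSign σ (-1 : K), normSign σ (-1 : K), 1] : Fin 3 → ℤ) i * (baseSign σ i * normSign σ (fPartProd δ ![a, b, 1] i)) : ℤ) : ℚ) *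
            ampl (Fintype.card 𝓀[K]) k B ∧
        ((∑ s : Fin 3 → Bool,
            (![(if s 1 then -1 else 1) * (if s 2 then -1 else 1),
               (if s 0 then -1 else 1) * (if s 2 then -1 else 1),
               (if s 0 then -1 else 1) * (if s 1 then -1 else 1)] : Fin 3 → ℤ) i *
              ({M : Submodule 𝒪[K] (Fin 3 → K) |
                IsVertexLattice σ ϖ (Matrix.diagonal fun j => if s j then c else (1 : K)) 2 M ∧ mapGL T M = M}.ncard : ℤ) : ℤ) : ℚ) =
          2 * (((![normSign σ (-1 : K), normSign σ (-1 : K), 1] : Fin 3 → ℤ) i * (baseSign σ i * normSign σ (fPartProd δ ![a, b, 1] i)) : ℤ) : ℚ) *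
            ampl (Fintype.card 𝓀[K]) k (B + tauOfRecord d)) :
    DyadicFence (K := K) (KappaSignLawAtR depthOfRecord tauOfRecord σ ϖ d t) := by
  intro _ hD
  exact kappaSignLawAtS_of_normIndexTwo_of_kappaSignModelSum8 shiftR depthOfRecord tauOfRecord σ ϖ d t (normIndexTwo σ ϖ d t hD) hKSS hD

end Reduction

end Summit.HodgeConjecture.HodgeConjecture.Cruxes.H413.F0P3cDyRamKappaSignLawOfKappaModelSum

end
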